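import Summits.QuantumFields.YangMills.Theorems.LangevinControlUVOSLegsFromFemtoAndGapStubAssemblyPermutations
import Summits.QuantumFields.YangMills.Theorems.LangevinControlUVOSLegsFromFemtoAndGapStubAssemblyPlaneStrings
import Summits.QuantumFields.YangMills.Theorems.LangevinControlUVOSLegsFromFemtoAndGapStubCollar
import Summits.QuantumFields.YangMills.Theorems.LangevinControlUVOSLegsAtWeakCouplingCStubInheritTorus

/-!
# Route `UniversalDetector`, support item `PlaneLimitExtraction` (stmt-QuantumFields-23251) — axis permutations

Ideator seat ym-idea-8 g7 (LINE 4 of rung R2a = `BalabanLadder.NT`).  The permutation-invariance clause of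
`PlaneLimitExtraction` (`K (z ∘ σ) = K z` for every permutation `σ` of the four axes) is EXACT on the lattice:
the truncated two-point function of the action density on the odd torus `2L+1` is invariant under coordinate
permutations of the sites.  This file bridges the route's covariance `Cov_T(dens x, dens y) =
torusE(dens x · dens y) − torusE(dens x) torusE(dens y)` to the spine toolkit's centred two-point moment
(`cov_dens_eq_torusMoment_two`, with `torusE_dens_eq_wilsonTorusMean`: the one-point function is translation
invariant) and imports the toolkit's `torusMoment_dens_permSites` (soft OS-assembly toolkit XXIII):
`cov_dens_permSites`, and in kernel form `cov_dens_zero_perm` — `Cov_T(dens 0, dens (z ∘ σ)) = Cov_T(dens 0, dens z)`.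
No summit, rung or crux is proved here.
-/

set_option autoImplicit false

noncomputable section

open MeasureTheory Filter Topology
open Literature.MathematicalPhysics.QuantumFieldTheory Literature.MathematicalPhysics.QuantumLattice
  Literature.Probability.LatticeModels
open Summit.QuantumFields.YangMills.Cruxes.OSLegsFromFemtoAndGap.DlrCollarTransfer
open Summit.QuantumFields.YangMills.Theorems.OSLegsFromFemtoAndGap (torusMoment permSites torusMoment_dens_permSites
  torusE_comp_configShift)
open Summit.QuantumFields.YangMills.Cruxes.OSLegsAtWeakCouplingC.InheritedAmplitudeGates.StubInherit
  (integrable_lift)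

namespace Summit.QuantumFields.YangMills.Cruxes.UniversalDetectorPlaneTight

variable {G : Type} [Group G] [TopologicalSpace G] [IsTopologicalGroup G] [CompactSpace G]
  [MeasurableSpace G] [BorelSpace G] (r : LatticeRep G)

/-- The one-point function of the action density is translation invariant: `E_T[dens x] = m_T` for every site. -/
theorem torusE_dens_eq_wilsonTorusMean (β : ℝ) (L : ℕ) (x : Site 4) :
    torusE G r β L (dens G r x) = wilsonTorusMean r.ρ β L r.curvature.F :=
  torusE_comp_configShift r β L r.curvature.F x

/-- **The truncated two-point function is the centred two-point moment of the spine toolkit**: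
`Cov_T(dens x, dens y) = W_T^{(2)}(x, y)` with the torus mean as the additive normalisation. -/
theorem cov_dens_eq_torusMoment_two (β : ℝ) (L : ℕ) (x y : Site 4) :
    torusE G r β L (fun V => dens G r x V * dens G r y V) - torusE G r β L (dens G r x) * torusE G r β L (dens G r y) =
      torusMoment r.ρ β L r.curvature.F (wilsonTorusMean r.ρ β L r.curvature.F) ![x, y] := by
  generalize hm : wilsonTorusMean r.ρ β L r.curvature.F = m
  have hx : torusE G r β L (dens G r x) = m := by rw [← hm]; exact torusE_dens_eq_wilsonTorusMean r β L x
  have hy : torusE G r β L (dens G r y) = m := by rw [← hm]; exact torusE_dens_eq_wilsonTorusMean r β L y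
  haveI := r.secondCountableTopology
  haveI := isProbabilityMeasure_wilsonMeasure (d := 4) (L := 2 * L + 1) r.ρ r.continuous β
  have h2 : torusMoment r.ρ β L r.curvature.F m ![x, y] =
      ∫ U, (dens G r x (torusLift (2 * L + 1) U) - m) * (dens G r y (torusLift (2 * L + 1) U) - m)
        ∂(wilsonMeasure (d := 4) (L := 2 * L + 1) r.ρ β) := by
    simp only [torusMoment, Fin.prod_univ_two, Matrix.cons_val_zero, Matrix.cons_val_one, dens]
  have iA : Integrable (fun U : GaugeConfig 4 (2 * L + 1) G => dens G r x (torusLift (2 * L + 1) U))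
      (wilsonMeasure (d := 4) (L := 2 * L + 1) r.ρ β) := integrable_lift G r β (F := dens G r x) (continuous_dens r x)
  have iB : Integrable (fun U : GaugeConfig 4 (2 * L + 1) G => dens G r y (torusLift (2 * L + 1) U))
      (wilsonMeasure (d := 4) (L := 2 * L + 1) r.ρ β) := integrable_lift G r β (F := dens G r y) (continuous_dens r y)
  have iAB : Integrable (fun U : GaugeConfig 4 (2 * L + 1) G =>
      dens G r x (torusLift (2 * L + 1) U) * dens G r y (torusLift (2 * L + 1) U))
      (wilsonMeasure (d := 4) (L := 2 * L + 1) r.ρ β) :=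
    integrable_lift G r β (F := fun V => dens G r x V * dens G r y V) ((continuous_dens r x).mul (continuous_dens r y))
  have h3 : (fun U : GaugeConfig 4 (2 * L + 1) G =>
      (dens G r x (torusLift (2 * L + 1) U) - m) * (dens G r y (torusLift (2 * L + 1) U) - m)) =
      fun U => (dens G r x (torusLift (2 * L + 1) U) * dens G r y (torusLift (2 * L + 1) U) -
        (m * dens G r x (torusLift (2 * L + 1) U) + m * dens G r y (torusLift (2 * L + 1) U))) + m * m := by
    funext U; ring
  have hc : ∫ _ : GaugeConfig 4 (2 * L + 1) G, m * m ∂(wilsonMeasure (d := 4) (L := 2 * L + 1) r.ρ β) = m * m := by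
    simp
  have e1 : ∫ U, (dens G r x (torusLift (2 * L + 1) U) * dens G r y (torusLift (2 * L + 1) U) -
        (m * dens G r x (torusLift (2 * L + 1) U) + m * dens G r y (torusLift (2 * L + 1) U))) + m * m
        ∂(wilsonMeasure (d := 4) (L := 2 * L + 1) r.ρ β) =
      (∫ U, dens G r x (torusLift (2 * L + 1) U) * dens G r y (torusLift (2 * L + 1) U) -
        (m * dens G r x (torusLift (2 * L + 1) U) + m * dens G r y (torusLift (2 * L + 1) U))
        ∂(wilsonMeasure (d := 4) (L := 2 * L + 1) r.ρ β)) +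
      ∫ _ : GaugeConfig 4 (2 * L + 1) G, m * m ∂(wilsonMeasure (d := 4) (L := 2 * L + 1) r.ρ β) :=
    integral_add (iAB.sub ((iA.const_mul m).add (iB.const_mul m))) (integrable_const _)
  have e2 : ∫ U, dens G r x (torusLift (2 * L + 1) U) * dens G r y (torusLift (2 * L + 1) U) -
        (m * dens G r x (torusLift (2 * L + 1) U) + m * dens G r y (torusLift (2 * L + 1) U))
        ∂(wilsonMeasure (d := 4) (L := 2 * L + 1) r.ρ β) =
      (∫ U, dens G r x (torusLift (2 * L + 1) U) * dens G r y (torusLift (2 * L + 1) U)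
        ∂(wilsonMeasure (d := 4) (L := 2 * L + 1) r.ρ β)) -
      ∫ U, m * dens G r x (torusLift (2 * L + 1) U) + m * dens G r y (torusLift (2 * L + 1) U)
        ∂(wilsonMeasure (d := 4) (L := 2 * L + 1) r.ρ β) :=
    integral_sub iAB ((iA.const_mul m).add (iB.const_mul m))
  have e3 : ∫ U, m * dens G r x (torusLift (2 * L + 1) U) + m * dens G r y (torusLift (2 * L + 1) U)
        ∂(wilsonMeasure (d := 4) (L := 2 * L + 1) r.ρ β) =
      (∫ U, m * dens G r x (torusLift (2 * L + 1) U) ∂(wilsonMeasure (d := 4) (L := 2 * L + 1) r.ρ β)) +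
      ∫ U, m * dens G r y (torusLift (2 * L + 1) U) ∂(wilsonMeasure (d := 4) (L := 2 * L + 1) r.ρ β) :=
    integral_add (iA.const_mul m) (iB.const_mul m)
  rw [h2, h3, e1, e2, e3, integral_const_mul, integral_const_mul, hc]
  unfold torusE at hx hy ⊢
  rw [hx, hy]
  ring

/-- **The truncated two-point function is invariant under coordinate permutations of the sites** (odd torus,
every coupling; soft OS-assembly toolkit XXIII). -/
theorem cov_dens_permSites (β : ℝ) (L : ℕ) (π : Equiv.Perm (Fin 4)) (x y : Site 4) :
    torusE G r β L (fun V => dens G r (fun i => x (π.symm i)) V * dens G r (fun i => y (π.symm i)) V) -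
        torusE G r β L (dens G r (fun i => x (π.symm i))) * torusE G r β L (dens G r (fun i => y (π.symm i))) =
      torusE G r β L (fun V => dens G r x V * dens G r y V) - torusE G r β L (dens G r x) * torusE G r β L (dens G r y) := by
  rw [cov_dens_eq_torusMoment_two, cov_dens_eq_torusMoment_two]
  have hp : permSites π ![x, y] = ![fun i => x (π.symm i), fun i => y (π.symm i)] := by
    funext l i
    fin_cases l <;> rfl
  rw [← hp]
  exact torusMoment_dens_permSites r β L π ![x, y]

/-- **Kernel form**: `Cov_T(dens 0, dens (z ∘ σ)) = Cov_T(dens 0, dens z)` for every permutation `σ` of the axes. -/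
theorem cov_dens_zero_perm (β : ℝ) (L : ℕ) (σ : Equiv.Perm (Fin 4)) (z : Site 4) :
    torusE G r β L (fun V => dens G r 0 V * dens G r (fun i => z (σ i)) V) -
        torusE G r β L (dens G r 0) * torusE G r β L (dens G r (fun i => z (σ i))) =
      torusE G r β L (fun V => dens G r 0 V * dens G r z V) - torusE G r β L (dens G r 0) * torusE G r β L (dens G r z) := by
  have h := cov_dens_permSites r β L σ.symm 0 z
  have h0 : (fun i => (0 : Site 4) (σ.symm.symm i)) = 0 := by funext i; rfl
  simp only [Equiv.symm_symm] at h h0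
  rw [h0] at h
  exact h

end Summit.QuantumFields.YangMills.Cruxes.UniversalDetectorPlaneTight

end
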